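import Literature.NumberTheory.EllipticCurves.ZpExtensionShapiroToEisensteinLocalTrianglesProofs
import Literature.NumberTheory.EllipticCurves.TowerExactFamiliesTransferProofs
import Literature.NumberTheory.EllipticCurves.ZpExtensionShapiroToEisensteinLevelMap
import HarnessLib

/-!
# Howard's Lemma 2.2.7 on the cell's towers: the level maps `f_{σ,k}` of the Kolyvagin-system pushforward carry
# `𝓕_Λ` (lit's `coeffSelmerStructure`, Shapiro level `σ`) into `F_𝔮` (D1's `eisensteinSelmerStructure`, level `k`)
# at EVERY place — the `cond_le` field of the ONE `Hom` from the `Λ`-adic source into the Eisenstein DVR setting (theorems only)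

Topic `NumberTheory/EllipticCurves` (sequel of `ZpExtensionShapiroToEisensteinLocalTrianglesProofs` (G4b-1) and
`TowerExactFamiliesTransferProofs` (G4a)).  Cell `pub/bsd-print-x9`, seat `bsd-line-x9-p2` g4, STUB A of the shared μ-crux.

Howard, Lemma 2.2.7 [arXiv:1202.6340 Lemma 3.2.7, p. 16 L142–148] with Rem. 1.2.4 (ii)+(iii) [p. 7 L13–27]: the change of
coefficients `𝐓/I𝐓 → T_𝔭/p^k` carries `H¹_{F_Λ}(K_v, ·)` into `H¹_{F_𝔭}(K_v, ·)` at every place `v`, which is what makes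
`KS(𝐓, F_Λ, 𝓛) → KS(T_𝔭, F_𝔭, 𝓛)` (proof of Thm. 2.2.10, first sentence) a map of Kolyvagin systems.  On the cell's finite
levels, for an admissible pair `(σ, k)` (`k ≤ σ`, `(ω_σ, p^σ) ≤ (q_m, p^k)`) and the SAME bad set `S ⊇ {v ∣ p}` and ordinary
data `Φ` on both sides:
* at an infinite place: the target condition is `⊤`;
* at `v ∣ p`: exact ORDINARY families of the source local tower ↦ compatible families in the strict ordinary cores of the
  target local tower (G4b-1: triangles + `coeffFil ↦ twistedFil`), which are saturated with exponent `0` (G4a);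
* at `v ∈ S`, `v ∤ p`: the source condition is the exact RELAXED one (CGLS «`H¹(K_w, 𝐓)` else»), the target the SATURATED
  UNRAMIFIED one; here the input is arithmetic: `p^c` kills `H¹(K_v, E[p^j] ⊗ A_{m,j}(ψ))` for all `j ≥ 1` (x9-p1-w4 g5's (N1),
  `exists_forall_pow_smul_galoisCohomology_one_toLocal_eq_zero`, valid for `m > 2N_v` at the places of `K` finitely decomposed in
  `K_∞`) — taken as the hypothesis `hS`; then every compatible family of the target is killed by `p^c` and the torsion variant of
  G4a applies;
* at every other finite place: unramified ↦ unramified.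
Main results: the four clauses, **`map_coeffSelmerStructure_le_eisensteinSelmerStructure`** (all places), and the bridge
`cohomologyMap_toLocal_shapiroToEisensteinLevelMap_eq` to the `ContinuousRep.cohomologyMap` spelling of
`CoeffTowerSetting.Hom.cond_le` on the level synonyms.  Theorems only; no named fact, no instance, no notation, no `sorry`.
BSD is not proved by any of this.

References: [Howard2004HeegnerKolyvagin] Rem. 1.2.4, Lemma 2.2.7, Def. 2.2.6, proof of Thm. 2.2.10 (arXiv p. 7 L13–27, p0016 L104–148,
p0017 L78–81); [CastellaGrossiLeeSkinner2022] §3.4 (𝓕_Λ; arXiv v2 TeX L2102–2108); [SerreGaloisCohomology1997] I §2.2, §2.4, II §6.1.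
-/

noncomputable section

open scoped TensorProduct Topology Classical ContRepresentation
open Field CategoryTheory IsLocalRing IsDedekindDomain
open scoped NumberField

namespace Literature.NumberTheory.EllipticCurves.ZpExtension

open Literature.NumberTheory.GaloisRepresentations
open Literature.NumberTheory.GaloisRepresentations.DiscreteGaloisModule (SelmerStructure)
open Literature.NumberTheory.GaloisCohomology.Howard2004

variable {K : Type} [Field K] [NumberField K] {V : WeierstrassCurve K} {p : ℕ} [hp : Fact p.Prime] (κ : ZpExtension K p)
  (t : ∀ k, (V.torsionGaloisModule ((p : ℤ) ^ (k + 1))).toContRepresentation →ⁱL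
    (V.torsionGaloisModule ((p : ℤ) ^ k)).toContRepresentation)
  (ht : ∀ k (P : WeierstrassCurve.geomTorsion V ((p : ℤ) ^ (k + 1))), t k P = V.geomTorsionReduce p k P)
  (hts : ∀ k, Function.Surjective (t k)) {m : ℕ} (hm : 1 ≤ m)
  (S : Finset (HeightOneSpectrum (𝓞 K)))
  (Φ : ∀ v : HeightOneSpectrum (𝓞 K), ((p : ℕ) : 𝓞 K) ∈ v.asIdeal →
    OrdinaryFiltration (fun j ↦ V.torsionGaloisModule ((p : ℤ) ^ j)) t v)

/-! ## §1 `v ∣ p`: exact ordinary ↦ saturated ordinary -/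

include ht in
/-- **Lemma 2.2.7 at `v ∣ p`**: `H¹(K_v, f_{σ,k})` carries `𝓕_Λ` (exact level condition of the ordinary tower of the Shapiro source,
level `σ`) into `F_𝔮` (saturated level condition of the strict ordinary tower of `T_𝔮`, level `k`).
[cite: Howard2004HeegnerKolyvagin, Lemma 2.2.7 and Def. 2.2.6 (arXiv p0016 L104–148)] [cite: CastellaGrossiLeeSkinner2022, §3.4 (arXiv v2 TeX L2102–2108)] -/
theorem map_coeffSelmerStructure_le_eisensteinSelmerStructure_of_mem (σ k : ℕ) (hσ : k ≤ σ)
    (hle : shapiroIdeal p σ ≤ Ideal.span {(PowerSeries.X ^ m + PowerSeries.C (p : ℤ_[p]) : IwasawaAlgebra p)} ⊔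
      Ideal.span {PowerSeries.C ((p : ℤ_[p]) ^ k)})
    {v : HeightOneSpectrum (𝓞 K)} (hv : ((p : ℕ) : 𝓞 K) ∈ v.asIdeal) :
    (κ.coeffSelmerStructure (fun j ↦ V.torsionGaloisModule ((p : ℤ) ^ j)) t (shapiroIdeal p) (shapiroIdeal_succ_le p)
        (fun j ↦ j) (omega_mem_shapiroIdeal p) (fun j ↦ j * p ^ j + j) (maximalIdeal_pow_le_shapiroIdeal p) hts S Φ σ
        (Sum.inr v)).map
      (galoisCohomology.map (DiscreteGaloisModule.localMap (κ.shapiroToEisensteinTwistLe V hm σ k hσ hle) (Sum.inr v)) 1) ≤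
      κ.eisensteinSelmerStructure (fun j ↦ V.torsionGaloisModule ((p : ℤ) ^ j)) t hm S Φ k (Sum.inr v) := by
  obtain ⟨σ₀, hσ₀⟩ := exists_forall_adm p (m := m) hm
  refine (AddSubgroup.map_mono (κ.coeffSelmerStructure_inr_of_mem (fun j ↦ V.torsionGaloisModule ((p : ℤ) ^ j)) t (shapiroIdeal p) (shapiroIdeal_succ_le p)
      (fun j ↦ j) (omega_mem_shapiroIdeal p) (fun j ↦ j * p ^ j + j) (maximalIdeal_pow_le_shapiroIdeal p) hts S Φ σ hv).le).trans ?_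
  refine le_trans ?_ (κ.eisensteinSelmerStructure_inr_of_mem (fun j ↦ V.torsionGaloisModule ((p : ℤ) ^ j)) t hm S Φ k hv).ge
  have key : (Tower.exactLevelCondition
      (κ.coeffLocalRed (fun j ↦ V.torsionGaloisModule ((p : ℤ) ^ j)) t (shapiroIdeal p) (shapiroIdeal_succ_le p)
        (fun j ↦ j) (omega_mem_shapiroIdeal p) (fun j ↦ j * p ^ j + j) (maximalIdeal_pow_le_shapiroIdeal p) hts (Sum.inr v))
      (fun j ↦ coeffOrdinaryCore (shapiroIdeal p) (shapiroIdeal_succ_le p) (fun j ↦ j) (omega_mem_shapiroIdeal p)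
        (fun j ↦ j * p ^ j + j) (maximalIdeal_pow_le_shapiroIdeal p) hts (Φ v hv) j) σ).map
      (galoisCohomology.map (DiscreteGaloisModule.localMap (κ.shapiroToEisensteinTwistLe V hm σ k hσ hle) (Sum.inr v)) 1) ≤
      Tower.levelCondition (κ.eisensteinLocalReduce (fun j ↦ V.torsionGaloisModule ((p : ℤ) ^ j)) t hm (Sum.inr v)) p
        (fun j ↦ (Φ v hv).ordinaryCore hm j) k :=
    Tower.map_exactLevelCondition_le_levelCondition
      (red := κ.coeffLocalRed (fun j ↦ V.torsionGaloisModule ((p : ℤ) ^ j)) t (shapiroIdeal p) (shapiroIdeal_succ_le p)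
        (fun j ↦ j) (omega_mem_shapiroIdeal p) (fun j ↦ j * p ^ j + j) (maximalIdeal_pow_le_shapiroIdeal p) hts (Sum.inr v))
      (red' := κ.eisensteinLocalReduce (fun j ↦ V.torsionGaloisModule ((p : ℤ) ^ j)) t hm (Sum.inr v))
      (Adm := fun σ k ↦ k ≤ σ ∧ shapiroIdeal p σ ≤
        Ideal.span {(PowerSeries.X ^ m + PowerSeries.C (p : ℤ_[p]) : IwasawaAlgebra p)} ⊔
          Ideal.span {PowerSeries.C ((p : ℤ_[p]) ^ k)})
      (g := fun σ k h ↦ galoisCohomology.map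
        (DiscreteGaloisModule.localMap (κ.shapiroToEisensteinTwistLe V hm σ k h.1 h.2) (Sum.inr v)) 1)
      (fun σ k h ↦ adm_succ_of_adm p m h)
      (fun σ k h h' y ↦ (κ.map_localMap_shapiroToEisensteinTwistLe_coeffLocalRed t ht hts hm (Sum.inr v) σ k h.1 h'.1
        h.2 h'.2 y).symm)
      (fun σ k h h' y ↦ κ.eisensteinLocalReduce_map_localMap_shapiroToEisensteinTwistLe t ht hts hm (Sum.inr v) σ k h.1
        h'.1 h.2 h'.2 y)
      σ₀ hσ₀ p
      (C := fun j ↦ coeffOrdinaryCore (shapiroIdeal p) (shapiroIdeal_succ_le p) (fun j ↦ j) (omega_mem_shapiroIdeal p)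
        (fun j ↦ j * p ^ j + j) (maximalIdeal_pow_le_shapiroIdeal p) hts (Φ v hv) j)
      (C' := fun j ↦ (Φ v hv).ordinaryCore hm j)
      (fun σ k h y hy ↦ κ.map_localMap_shapiroToEisensteinTwistLe_mem_ordinaryCore t ht hts hm (Φ v hv) σ k h.1 h.2 hy)
      k ⟨hσ, hle⟩
  exact key

/-! ## §2 `v ∈ S`, `v ∤ p`: exact relaxed ↦ saturated unramified, given the local torsion bound -/

/-- If `p^c` kills `H¹(K_v, W_j)` for every `j ≥ 1`, it kills every compatible family of the local tower of `T_𝔮` at `v`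
(the level `0` component is the reduction of the level `1` component). [cite: Howard2004HeegnerKolyvagin, Def. 2.1.1 (propagation from V: saturation) and Lemma 2.2.7] -/
theorem forall_pow_smul_eq_zero_of_mem_compatibleFamilies (v : NumberField.Place K) {c : ℕ}
    (hc : ∀ j, 1 ≤ j → ∀ x : galoisCohomology
      ((κ.eisensteinTwist (V.torsionGaloisModule ((p : ℤ) ^ j)) hm j).toLocal v) 1, p ^ c • x = 0)
    {y : ∀ j, galoisCohomology ((κ.eisensteinTwist (V.torsionGaloisModule ((p : ℤ) ^ j)) hm j).toLocal v) 1}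
    (hy : y ∈ Tower.compatibleFamilies (κ.eisensteinLocalReduce (fun j ↦ V.torsionGaloisModule ((p : ℤ) ^ j)) t hm v)) (j : ℕ) :
    p ^ c • y j = 0 := by
  rcases j with _ | j
  · rw [← (Tower.mem_compatibleFamilies_iff _ y).1 hy 0, ← map_nsmul, hc 1 le_rfl, map_zero]
  · exact hc (j + 1) j.succ_pos _

include ht in
/-- **Lemma 2.2.7 at `v ∈ S`, `v ∤ p`** (the bad places away from `p`): given that `p^c` kills `H¹(K_v, E[p^j] ⊗ A_{m,j}(ψ))` for
all `j ≥ 1` (the (N1) bound, `m > 2N_v`), `H¹(K_v, f_{σ,k})` carries the exact relaxed condition of the source into the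
saturated unramified condition of the target. [cite: Howard2004HeegnerKolyvagin, Lemma 2.2.7 and Def. 2.1.1 (arXiv p. 5, p0016 L142–148)] [cite: CastellaGrossiLeeSkinner2022, §3.4 («H¹(K_w, 𝐓) else»)] -/
theorem map_coeffSelmerStructure_le_eisensteinSelmerStructure_of_mem_of_not_mem (σ k : ℕ) (hσ : k ≤ σ)
    (hle : shapiroIdeal p σ ≤ Ideal.span {(PowerSeries.X ^ m + PowerSeries.C (p : ℤ_[p]) : IwasawaAlgebra p)} ⊔
      Ideal.span {PowerSeries.C ((p : ℤ_[p]) ^ k)})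
    {v : HeightOneSpectrum (𝓞 K)} (hv : ((p : ℕ) : 𝓞 K) ∉ v.asIdeal) (hvS : v ∈ S)
    (hN : ∃ c : ℕ, ∀ j, 1 ≤ j → ∀ x : galoisCohomology
      ((κ.eisensteinTwist (V.torsionGaloisModule ((p : ℤ) ^ j)) hm j).toLocal (Sum.inr v)) 1, p ^ c • x = 0) :
    (κ.coeffSelmerStructure (fun j ↦ V.torsionGaloisModule ((p : ℤ) ^ j)) t (shapiroIdeal p) (shapiroIdeal_succ_le p)
        (fun j ↦ j) (omega_mem_shapiroIdeal p) (fun j ↦ j * p ^ j + j) (maximalIdeal_pow_le_shapiroIdeal p) hts S Φ σ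
        (Sum.inr v)).map
      (galoisCohomology.map (DiscreteGaloisModule.localMap (κ.shapiroToEisensteinTwistLe V hm σ k hσ hle) (Sum.inr v)) 1) ≤
      κ.eisensteinSelmerStructure (fun j ↦ V.torsionGaloisModule ((p : ℤ) ^ j)) t hm S Φ k (Sum.inr v) := by
  obtain ⟨σ₀, hσ₀⟩ := exists_forall_adm p (m := m) hm
  obtain ⟨c, hc⟩ := hN
  refine (AddSubgroup.map_mono (κ.coeffSelmerStructure_inr_of_mem_of_not_mem (fun j ↦ V.torsionGaloisModule ((p : ℤ) ^ j)) t (shapiroIdeal p) (shapiroIdeal_succ_le p)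
      (fun j ↦ j) (omega_mem_shapiroIdeal p) (fun j ↦ j * p ^ j + j) (maximalIdeal_pow_le_shapiroIdeal p) hts S Φ σ hv hvS).le).trans ?_
  refine le_trans ?_ (κ.eisensteinSelmerStructure_inr_of_mem_of_not_mem (fun j ↦ V.torsionGaloisModule ((p : ℤ) ^ j)) t hm S Φ k hv hvS).ge
  have key : (Tower.exactLevelCondition
      (κ.coeffLocalRed (fun j ↦ V.torsionGaloisModule ((p : ℤ) ^ j)) t (shapiroIdeal p) (shapiroIdeal_succ_le p)
        (fun j ↦ j) (omega_mem_shapiroIdeal p) (fun j ↦ j * p ^ j + j) (maximalIdeal_pow_le_shapiroIdeal p) hts (Sum.inr v))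
      (fun j ↦ (⊤ : AddSubgroup (galoisCohomology (((κ.coeffAdicTower (fun j ↦ V.torsionGaloisModule ((p : ℤ) ^ j)) t (shapiroIdeal p) (shapiroIdeal_succ_le p)
      (fun j ↦ j) (omega_mem_shapiroIdeal p) (fun j ↦ j * p ^ j + j) (maximalIdeal_pow_le_shapiroIdeal p) hts).ρ j).toLocal (Sum.inr v)) 1))) σ).map
      (galoisCohomology.map (DiscreteGaloisModule.localMap (κ.shapiroToEisensteinTwistLe V hm σ k hσ hle) (Sum.inr v)) 1) ≤
      Tower.levelCondition (κ.eisensteinLocalReduce (fun j ↦ V.torsionGaloisModule ((p : ℤ) ^ j)) t hm (Sum.inr v)) p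
        (fun j ↦ DiscreteGaloisModule.unramifiedSubgroup
          (GaloisRep.toLocal v (κ.eisensteinTwist (V.torsionGaloisModule ((p : ℤ) ^ j)) hm j)) 1) k :=
    Tower.map_exactLevelCondition_le_levelCondition_of_forall_nsmul_eq_zero
      (H' := fun j ↦ galoisCohomology ((κ.eisensteinTwist (V.torsionGaloisModule ((p : ℤ) ^ j)) hm j).toLocal (Sum.inr v)) 1)
      (red := κ.coeffLocalRed (fun j ↦ V.torsionGaloisModule ((p : ℤ) ^ j)) t (shapiroIdeal p) (shapiroIdeal_succ_le p)
        (fun j ↦ j) (omega_mem_shapiroIdeal p) (fun j ↦ j * p ^ j + j) (maximalIdeal_pow_le_shapiroIdeal p) hts (Sum.inr v))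
      (red' := κ.eisensteinLocalReduce (fun j ↦ V.torsionGaloisModule ((p : ℤ) ^ j)) t hm (Sum.inr v))
      (Adm := fun σ k ↦ k ≤ σ ∧ shapiroIdeal p σ ≤
        Ideal.span {(PowerSeries.X ^ m + PowerSeries.C (p : ℤ_[p]) : IwasawaAlgebra p)} ⊔
          Ideal.span {PowerSeries.C ((p : ℤ_[p]) ^ k)})
      (g := fun σ k h ↦ galoisCohomology.map
        (DiscreteGaloisModule.localMap (κ.shapiroToEisensteinTwistLe V hm σ k h.1 h.2) (Sum.inr v)) 1)
      (fun σ k h ↦ adm_succ_of_adm p m h)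
      (fun σ k h h' y ↦ (κ.map_localMap_shapiroToEisensteinTwistLe_coeffLocalRed t ht hts hm (Sum.inr v) σ k h.1 h'.1
        h.2 h'.2 y).symm)
      (fun σ k h h' y ↦ κ.eisensteinLocalReduce_map_localMap_shapiroToEisensteinTwistLe t ht hts hm (Sum.inr v) σ k h.1
        h'.1 h.2 h'.2 y)
      σ₀ hσ₀ p c (fun y hy j ↦ κ.forall_pow_smul_eq_zero_of_mem_compatibleFamilies t hm (Sum.inr v) hc hy j)
      (C := fun j ↦ (⊤ : AddSubgroup (galoisCohomology (((κ.coeffAdicTower (fun j ↦ V.torsionGaloisModule ((p : ℤ) ^ j)) t (shapiroIdeal p) (shapiroIdeal_succ_le p)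
      (fun j ↦ j) (omega_mem_shapiroIdeal p) (fun j ↦ j * p ^ j + j) (maximalIdeal_pow_le_shapiroIdeal p) hts).ρ j).toLocal (Sum.inr v)) 1)))
      (C' := fun j ↦ DiscreteGaloisModule.unramifiedSubgroup
          (GaloisRep.toLocal v (κ.eisensteinTwist (V.torsionGaloisModule ((p : ℤ) ^ j)) hm j)) 1)
      k ⟨hσ, hle⟩
  exact key

/-! ## §3 The other finite places: unramified ↦ unramified -/

/-- **Outside `S ∪ {v ∣ p}`**: `H¹(K_v, f_{σ,k})` carries `H¹_ur` into `H¹_ur`.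
[cite: Howard2004HeegnerKolyvagin, Def. 1.1.1, Lemma 1.1.9 and Def. 2.2.6 (arXiv pp. 5, 16)] -/
theorem map_coeffSelmerStructure_le_eisensteinSelmerStructure_of_not_mem (σ k : ℕ) (hσ : k ≤ σ)
    (hle : shapiroIdeal p σ ≤ Ideal.span {(PowerSeries.X ^ m + PowerSeries.C (p : ℤ_[p]) : IwasawaAlgebra p)} ⊔
      Ideal.span {PowerSeries.C ((p : ℤ_[p]) ^ k)})
    {v : HeightOneSpectrum (𝓞 K)} (hv : ((p : ℕ) : 𝓞 K) ∉ v.asIdeal) (hvS : v ∉ S) :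
    (κ.coeffSelmerStructure (fun j ↦ V.torsionGaloisModule ((p : ℤ) ^ j)) t (shapiroIdeal p) (shapiroIdeal_succ_le p)
        (fun j ↦ j) (omega_mem_shapiroIdeal p) (fun j ↦ j * p ^ j + j) (maximalIdeal_pow_le_shapiroIdeal p) hts S Φ σ
        (Sum.inr v)).map
      (galoisCohomology.map (DiscreteGaloisModule.localMap (κ.shapiroToEisensteinTwistLe V hm σ k hσ hle) (Sum.inr v)) 1) ≤
      κ.eisensteinSelmerStructure (fun j ↦ V.torsionGaloisModule ((p : ℤ) ^ j)) t hm S Φ k (Sum.inr v) := by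
  rintro _ ⟨c, hc, rfl⟩
  exact (κ.eisensteinSelmerStructure_inr_of_not_mem (fun j ↦ V.torsionGaloisModule ((p : ℤ) ^ j)) t hm S Φ k hv hvS).ge
    (κ.map_localMap_shapiroToEisensteinTwistLe_mem_unramifiedSubgroup t hts hm σ k hσ hle
      ((κ.coeffSelmerStructure_inr_of_not_mem (fun j ↦ V.torsionGaloisModule ((p : ℤ) ^ j)) t (shapiroIdeal p) (shapiroIdeal_succ_le p)
      (fun j ↦ j) (omega_mem_shapiroIdeal p) (fun j ↦ j * p ^ j + j) (maximalIdeal_pow_le_shapiroIdeal p) hts S Φ σ hv hvS).le hc))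

/-! ## §4 All places -/

include ht in
/-- **Howard's Lemma 2.2.7 on the cell's towers, all places**: for an admissible `(σ, k)`, the SAME `S ⊇ {v ∣ p}` and `Φ` on both
sides, and the (N1) local torsion bound at the places of `S` away from `p`, `H¹(K_v, f_{σ,k})` carries `𝓕_Λ` at Shapiro
level `σ` into `F_𝔮` at level `k` at every place `v` — the `cond_le` field of the pushforward `Hom` (Rem. 1.2.4 (ii)+(iii)).
[cite: Howard2004HeegnerKolyvagin, Lemma 2.2.7, Rem. 1.2.4 and proof of Thm. 2.2.10 (arXiv p. 7 L13–27, p0016 L142–148, p0017 L78–81)] -/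
theorem map_coeffSelmerStructure_le_eisensteinSelmerStructure (σ k : ℕ) (hσ : k ≤ σ)
    (hle : shapiroIdeal p σ ≤ Ideal.span {(PowerSeries.X ^ m + PowerSeries.C (p : ℤ_[p]) : IwasawaAlgebra p)} ⊔
      Ideal.span {PowerSeries.C ((p : ℤ_[p]) ^ k)})
    (hS : ∀ v ∈ S, ((p : ℕ) : 𝓞 K) ∉ v.asIdeal → ∃ c : ℕ, ∀ j, 1 ≤ j → ∀ x : galoisCohomology
      ((κ.eisensteinTwist (V.torsionGaloisModule ((p : ℤ) ^ j)) hm j).toLocal (Sum.inr v)) 1, p ^ c • x = 0)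
    (v : NumberField.Place K) :
    (κ.coeffSelmerStructure (fun j ↦ V.torsionGaloisModule ((p : ℤ) ^ j)) t (shapiroIdeal p) (shapiroIdeal_succ_le p)
        (fun j ↦ j) (omega_mem_shapiroIdeal p) (fun j ↦ j * p ^ j + j) (maximalIdeal_pow_le_shapiroIdeal p) hts S Φ σ v).map
      (galoisCohomology.map (DiscreteGaloisModule.localMap (κ.shapiroToEisensteinTwistLe V hm σ k hσ hle) v) 1) ≤
      κ.eisensteinSelmerStructure (fun j ↦ V.torsionGaloisModule ((p : ℤ) ^ j)) t hm S Φ k v := by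
  rcases v with w | v
  · exact le_of_le_of_eq le_top (κ.eisensteinSelmerStructure_inl (fun j ↦ V.torsionGaloisModule ((p : ℤ) ^ j)) t hm S Φ k w).symm
  · by_cases hv : ((p : ℕ) : 𝓞 K) ∈ v.asIdeal
    · exact κ.map_coeffSelmerStructure_le_eisensteinSelmerStructure_of_mem t ht hts hm S Φ σ k hσ hle hv
    · by_cases hvS : v ∈ S
      · exact κ.map_coeffSelmerStructure_le_eisensteinSelmerStructure_of_mem_of_not_mem t ht hts hm S Φ σ k hσ hle hv hvS
          (hS v hvS hv)
      · exact κ.map_coeffSelmerStructure_le_eisensteinSelmerStructure_of_not_mem t hts hm S Φ σ k hσ hle hv hvS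

/-! ## §5 Bridge to the `ContinuousRep.cohomologyMap` spelling of `Hom.cond_le` on the level synonyms -/

omit [NumberField K] in
/-- On the level synonyms (`CoeffLevel` / `EisensteinLevel`) the local `ContinuousRep.cohomologyMap` of the additive level map
`shapiroToEisensteinLevelMap` (any equivariance proof) IS `galoisCohomology.map (localMap (shapiroToEisensteinTwistLe …) v) 1`.
[cite: SerreGaloisCohomology1997, I §2.2 and II §6.1] [cite: Howard2004HeegnerKolyvagin, Rem. 1.2.4 (iii)] -/
theorem cohomologyMap_toLocal_shapiroToEisensteinLevelMap_eq [NumberField K] (v : NumberField.Place K) (σ k : ℕ) (hσ : k ≤ σ)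
    (hle : shapiroIdeal p σ ≤ Ideal.span {(PowerSeries.X ^ m + PowerSeries.C (p : ℤ_[p]) : IwasawaAlgebra p)} ⊔
      Ideal.span {PowerSeries.C ((p : ℤ_[p]) ^ k)})
    (h : ∀ (g : absoluteGaloisGroup (NumberField.Place.Completion v))
      (x : CoeffLevel p (shapiroIdeal p) (fun j ↦ WeierstrassCurve.geomTorsion V ((p : ℤ) ^ j)) σ),
      κ.shapiroToEisensteinLevelMap V hm σ k hσ hle
          ((((κ.coeffAdicTower (fun j ↦ V.torsionGaloisModule ((p : ℤ) ^ j)) t (shapiroIdeal p) (shapiroIdeal_succ_le p)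
            (fun j ↦ j) (omega_mem_shapiroIdeal p) (fun j ↦ j * p ^ j + j) (maximalIdeal_pow_le_shapiroIdeal p) hts).ρ σ).toLocal
            v) g x) =
        (((κ.eisensteinTwist (V.torsionGaloisModule ((p : ℤ) ^ k)) hm k :
          ContinuousRep (absoluteGaloisGroup K) ℤ
            (EisensteinLevel p m (fun j ↦ WeierstrassCurve.geomTorsion V ((p : ℤ) ^ j)) k))).toLocal v) g
          (κ.shapiroToEisensteinLevelMap V hm σ k hσ hle x)) :
    ContinuousRep.cohomologyMap
        (((κ.coeffAdicTower (fun j ↦ V.torsionGaloisModule ((p : ℤ) ^ j)) t (shapiroIdeal p) (shapiroIdeal_succ_le p)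
          (fun j ↦ j) (omega_mem_shapiroIdeal p) (fun j ↦ j * p ^ j + j) (maximalIdeal_pow_le_shapiroIdeal p) hts).ρ σ).toLocal v)
        (((κ.eisensteinTwist (V.torsionGaloisModule ((p : ℤ) ^ k)) hm k :
          ContinuousRep (absoluteGaloisGroup K) ℤ
            (EisensteinLevel p m (fun j ↦ WeierstrassCurve.geomTorsion V ((p : ℤ) ^ j)) k))).toLocal v)
        (κ.shapiroToEisensteinLevelMap V hm σ k hσ hle) continuous_of_discreteTopology h 1 =
      galoisCohomology.map (DiscreteGaloisModule.localMap (κ.shapiroToEisensteinTwistLe V hm σ k hσ hle) v) 1 := by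
  refine AddMonoidHom.ext fun y ↦ ?_
  obtain ⟨φ, rfl⟩ := oneCocycleClass_surjective _ y
  change ContinuousCohomology.map _ _ 1 _ = ContinuousCohomology.map _ _ 1 _
  erw [map_oneCocycleClass]

end Literature.NumberTheory.EllipticCurves.ZpExtension

end
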